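import Summits.RiemannHypothesis.RiemannHypothesis.Theorems.MotivicDoor.AWS.ForcingUp
import Summits.RiemannHypothesis.MotivicDoor.AWS.ForcingDown
import Summits.RiemannHypothesis.RiemannHypothesis.Theorems.PfPersistenceGalerkinLinearDensity

/-!
# AWS sprint, GENERATORS-UP (part 3): the canonical prime-side lattice of a generating family

HONEST LABEL.  One-way implication from a strengthened, prime-side-only axiom system; the existence
of an `ArithmeticWeilSurface` built INDEPENDENTLY (geometrically) is NOT claimed and is the located
gap.  THIS FILE IS THE HONESTY AUDIT in kernel form (coordinator gate 2026-08-19T21:51Z, item (2);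
`AXIOM-CONTENT.md` §2; AWS-DESIGN §6/§8(a); REFEREE-1 P3): satisfiability of the axiom list is
EQUIVALENT to RH — forward direction by forcing (`riemannHypothesis_of_arithmeticWeilSurface`,
aws-3), converse by the tautological (bookkeeping) carrier below.  Framing: lottery ticket at the
motivic door; RH probability negligible; consolation prizes are real: a new semi-local
Weil-positivity theorem, or a located gap in the Connes–Consani programme, plus the ff-door theorem.

## Content (all PROVED, no `sorry`, no zeros of `ζ` as input)

For ANY generating family `G`, GENERATORS-UP = extend the prime-side data from the generators to the
free lattice `G.PrimeLattice = (G.ι →₀ ℤ) × ℤ × ℤ` by (bi)additivity: `dstarHom`, `duHom` (masses,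
additive via `weilMellin_add` and the PROVED bridges `weilMellin_zero_eq_massDstar`,
`weilMellin_one_eq_massDu`), `crossHom` (`(c,c') ↦ Re W(g_c ⋆ g̃_{c'})`, biadditive and symmetric
— REFEREE-1 P3's bilinearity lemma — via `PfPersistence.weilCross_add_left/right` and
`weilFunctional_weilConv_weilReflect_swap_of_real`); the DECREED pairing `primeInter`
`(c,a,b)·(c',a',b') = d*(c)d_u(c') + d*(c')d_u(c) − Re W(g_c ⋆ g̃_{c'}) + a d*(c') + a' d*(c)
 + b d_u(c') + b' d_u(c) + (a b' + a' b)`, rulings `primeE₁ = (0,1,0)`, `primeE₂ = (0,0,1)`,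
classes `primeFrob i = (δ_i,0,0)`; EVERY `ArithmeticWeilSurface` FIELD EXCEPT `hodge` verified
(`primeInter_comm`, `primeInter_e₁_e₁/e₂_e₂/e₁_e₂`, `primeFrob_e₁/e₂/frob` — the last by
`two_mul_ccPairing_sub_two_mul_masses_eq`), packaged as
`G.ofHodge : G.PrimeHodge → ArithmeticWeilSurface` (coordinator item (2): the non-sign axioms are
instantiable from prime-side data alone; the sign condition is the single missing thing);
`sum_sum_primeInter`: `Σ a_k a_l v_k·v_l = 2(Σ a_k v_k·e₁)(Σ a_k v_k·e₂) − Re Q(Σ a_k g_{c_k})`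
(Gram expansion `PfPersistence.weilQuadratic_sum_eq_sum_weilCross`), whence
`primeHodge_iff_riemannHypothesis : G.PrimeHodge ↔ RH` and
`nonempty_arithmeticWeilSurface_iff_riemannHypothesis : Nonempty ArithmeticWeilSurface ↔ RH`
(← canonical carrier of `monomialBumpFamily`; → aws-3's `riemannHypothesis_of_arithmeticWeilSurface`).
READING (referees' verdict, now kernel-exact for literally this structure): `Nonempty AWS` is RH in
structure clothing; the sprint theorem's content is "Hodge index on the lattice + density ⇒ Weil
positivity"; the located gap is an INDEPENDENT construction in which `hodge` is a theorem.
-/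

noncomputable section

open Complex Set MeasureTheory Literature.NumberTheory.LFunctions
open Literature.NumberTheory.ConnesConsani2019
open Summit.RiemannHypothesis.RiemannHypothesis.Theorems.MotivicDoor.ConnesConsani
open Summit.RiemannHypothesis.RiemannHypothesis.Theorems.PfPersistence
  (weilCross weilCross_add_left weilCross_add_right weilQuadratic_sum_eq_sum_weilCross)
open scoped BigOperators ComplexConjugate

namespace Summit.RiemannHypothesis.RiemannHypothesis.Theorems.MotivicDoor.AWS

namespace GeneratingFamily

variable (G : GeneratingFamily)

/-! ## Integer combinations of the generators, complexified -/

/-- The complexified integer combination `g_c = (u_c : ℂ)`, `u_c = Σ c_i φ_i`. -/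
def ctest (c : G.ι →₀ ℤ) : ℝ → ℂ := fun t ↦ (testCombination G.φ c t : ℂ)

/-- `g_c` is a Weil test function. -/
theorem isWeilTest_ctest (c : G.ι →₀ ℤ) : IsWeilTest (G.ctest c) := by
  classical
  have key : ∀ s : Finset G.ι,
      IsWeilTest fun t ↦ ∑ i ∈ s, ((c i : ℝ) : ℂ) * (G.φ i t : ℂ) := by
    intro s
    induction s using Finset.induction_on with
    | empty =>
      simp only [Finset.sum_empty]
      exact ⟨contDiff_const, HasCompactSupport.zero⟩
    | insert i s hi ih =>
      simpa [Finset.sum_insert hi, Pi.add_def] using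
        ((G.isWeilTest i).const_mul ((c i : ℝ) : ℂ)).add ih
  convert key c.support using 2 with t
  simp [ctest, testCombination, Finsupp.sum, Complex.ofReal_sum, Complex.ofReal_mul]

/-- `g_{c + c'} = g_c + g_{c'}`. -/
theorem ctest_add (c c' : G.ι →₀ ℤ) : G.ctest (c + c') = G.ctest c + G.ctest c' := by
  funext t
  simp [ctest, ForcingUp.testCombination_add]

/-- `g_c` is real-valued. -/
theorem conj_ctest (c : G.ι →₀ ℤ) (t : ℝ) : conj (G.ctest c t) = G.ctest c t :=
  Complex.conj_ofReal _

/-! ## The prime-side data as (bi)additive maps on the free lattice (GENERATORS-UP) -/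

/-- `∫ f_c d*u = Re ĝ_c(0)`. -/
theorem massDstar_eq_re (c : G.ι →₀ ℤ) :
    massDstar (toMul (testCombination G.φ c)) = (weilMellin (G.ctest c) 0).re := by
  rw [show G.ctest c = fun t ↦ ((testCombination G.φ c t : ℝ) : ℂ) from rfl,
    weilMellin_zero_eq_massDstar, Complex.ofReal_re]

/-- `∫ f_c du = Re ĝ_c(1)`. -/
theorem massDu_eq_re (c : G.ι →₀ ℤ) :
    massDu (toMul (testCombination G.φ c)) = (weilMellin (G.ctest c) 1).re := by
  rw [show G.ctest c = fun t ↦ ((testCombination G.φ c t : ℝ) : ℂ) from rfl,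
    weilMellin_one_eq_massDu, Complex.ofReal_re]

/-- The mass `c ↦ ∫ f_c d*u` is ADDITIVE on the free lattice. -/
def dstarHom : (G.ι →₀ ℤ) →+ ℝ :=
  AddMonoidHom.mk' (fun c ↦ massDstar (toMul (testCombination G.φ c))) fun c c' ↦ by
    have hc := G.isWeilTest_ctest c
    have hc' := G.isWeilTest_ctest c'
    rw [massDstar_eq_re, massDstar_eq_re, massDstar_eq_re, ctest_add,
      weilMellin_add hc.1.continuous hc.2 hc'.1.continuous hc'.2, Complex.add_re]

/-- The mass `c ↦ ∫ f_c du` is ADDITIVE on the free lattice. -/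
def duHom : (G.ι →₀ ℤ) →+ ℝ :=
  AddMonoidHom.mk' (fun c ↦ massDu (toMul (testCombination G.φ c))) fun c c' ↦ by
    have hc := G.isWeilTest_ctest c
    have hc' := G.isWeilTest_ctest c'
    rw [massDu_eq_re, massDu_eq_re, massDu_eq_re, ctest_add,
      weilMellin_add hc.1.continuous hc.2 hc'.1.continuous hc'.2, Complex.add_re]

/-- Unfolding `dstarHom`. -/
theorem dstarHom_apply (c : G.ι →₀ ℤ) :
    G.dstarHom c = massDstar (toMul (testCombination G.φ c)) := rfl

/-- Unfolding `duHom`. -/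
theorem duHom_apply (c : G.ι →₀ ℤ) :
    G.duHom c = massDu (toMul (testCombination G.φ c)) := rfl

/-- The real cross term `Re W(g_c ⋆ g̃_{c'})` of Weil's functional. -/
def crossRe (c c' : G.ι →₀ ℤ) : ℝ := (weilCross (G.ctest c) (G.ctest c')).re

/-- Additivity of the real cross term in the first slot. -/
theorem crossRe_add_left (c₁ c₂ c' : G.ι →₀ ℤ) :
    G.crossRe (c₁ + c₂) c' = G.crossRe c₁ c' + G.crossRe c₂ c' := by
  simp only [crossRe, ctest_add, weilCross_add_left (G.isWeilTest_ctest c₁) (G.isWeilTest_ctest c₂)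
    (G.isWeilTest_ctest c'), Complex.add_re]

/-- Additivity of the real cross term in the second slot. -/
theorem crossRe_add_right (c c₁ c₂ : G.ι →₀ ℤ) :
    G.crossRe c (c₁ + c₂) = G.crossRe c c₁ + G.crossRe c c₂ := by
  simp only [crossRe, ctest_add, weilCross_add_right (G.isWeilTest_ctest c) (G.isWeilTest_ctest c₁)
    (G.isWeilTest_ctest c₂), Complex.add_re]

/-- Symmetry of the real cross term (real tests: `W(v ⋆ ũ) = W(u ⋆ ṽ)`). -/
theorem crossRe_comm (c c' : G.ι →₀ ℤ) : G.crossRe c c' = G.crossRe c' c := by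
  simp only [crossRe, weilCross]
  rw [weilFunctional_weilConv_weilReflect_swap_of_real (G.conj_ctest c') (G.conj_ctest c)]

/-- The diagonal of the cross term is Weil's quadratic functional. -/
theorem crossRe_self (c : G.ι →₀ ℤ) : G.crossRe c c = (weilQuadratic (G.ctest c)).re := rfl

/-- **REFEREE-1 P3 (bilinearity lemma)**: `(c, c') ↦ Re W(g_c ⋆ g̃_{c'})` is BIADDITIVE on the
free lattice. -/
def crossHom : (G.ι →₀ ℤ) →+ (G.ι →₀ ℤ) →+ ℝ :=
  AddMonoidHom.mk' (fun c ↦ AddMonoidHom.mk' (G.crossRe c) (G.crossRe_add_right c))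
    fun c₁ c₂ ↦ AddMonoidHom.ext fun c' ↦ G.crossRe_add_left c₁ c₂ c'

/-- Unfolding `crossHom`. -/
theorem crossHom_apply (c c' : G.ι →₀ ℤ) : G.crossHom c c' = G.crossRe c c' := rfl

/-! ## The canonical prime-side carrier -/

/-- The free lattice on the generators plus the two rulings. -/
abbrev PrimeLattice : Type := (G.ι →₀ ℤ) × ℤ × ℤ

/-- The decreed pairing, as a function. -/
def interFun (x y : G.PrimeLattice) : ℝ :=
  G.dstarHom x.1 * G.duHom y.1 + G.dstarHom y.1 * G.duHom x.1 - G.crossHom x.1 y.1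
    + (x.2.1 : ℝ) * G.dstarHom y.1 + (y.2.1 : ℝ) * G.dstarHom x.1
    + (x.2.2 : ℝ) * G.duHom y.1 + (y.2.2 : ℝ) * G.duHom x.1
    + ((x.2.1 : ℝ) * y.2.2 + (y.2.1 : ℝ) * x.2.2)

/-- The decreed pairing is symmetric. -/
theorem interFun_comm (x y : G.PrimeLattice) : G.interFun x y = G.interFun y x := by
  simp only [interFun, crossHom_apply]
  rw [G.crossRe_comm y.1 x.1]
  ring

/-- The decreed pairing is additive in the second variable. -/
theorem interFun_add_right (x y y' : G.PrimeLattice) :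
    G.interFun x (y + y') = G.interFun x y + G.interFun x y' := by
  simp only [interFun, Prod.fst_add, Prod.snd_add, map_add, Int.cast_add]
  ring

/-- The decreed pairing is additive in the first variable. -/
theorem interFun_add_left (x x' y : G.PrimeLattice) :
    G.interFun (x + x') y = G.interFun x y + G.interFun x' y := by
  rw [interFun_comm, interFun_add_right, interFun_comm G y x, interFun_comm G y x']

/-- **The decreed pairing of the canonical carrier** (biadditive):
`(c,a,b)·(c',a',b') = d*(c)d_u(c') + d*(c')d_u(c) − Re W(g_c ⋆ g̃_{c'}) + a d*(c') + a' d*(c)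
 + b d_u(c') + b' d_u(c) + (a b' + a' b)`. -/
def primeInter : G.PrimeLattice →+ G.PrimeLattice →+ ℝ :=
  AddMonoidHom.mk' (fun x ↦ AddMonoidHom.mk' (G.interFun x) (G.interFun_add_right x))
    fun x x' ↦ AddMonoidHom.ext fun y ↦ G.interFun_add_left x x' y

/-- Unfolding `primeInter`. -/
@[simp] theorem primeInter_apply (x y : G.PrimeLattice) : G.primeInter x y = G.interFun x y := rfl

/-- The first ruling `e₁ = (0, 1, 0)`. -/
def primeE₁ : G.PrimeLattice := (0, 1, 0)

/-- The second ruling `e₂ = (0, 0, 1)`. -/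
def primeE₂ : G.PrimeLattice := (0, 0, 1)

/-- The Frobenius-type class of the generator `i`: the basis vector `(δ_i, 0, 0)`. -/
def primeFrob (i : G.ι) : G.PrimeLattice := (Finsupp.single i 1, 0, 0)

/-- Field `inter_comm`: the pairing is symmetric. -/
theorem primeInter_comm (x y : G.PrimeLattice) : G.primeInter x y = G.primeInter y x :=
  G.interFun_comm x y

/-- `(c,a,b)·e₁ = d*(c) + b`. -/
@[simp] theorem primeInter_e₁_right (x : G.PrimeLattice) :
    G.primeInter x G.primeE₁ = G.dstarHom x.1 + x.2.2 := by
  simp [primeE₁, interFun]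

/-- `(c,a,b)·e₂ = d_u(c) + a`. -/
@[simp] theorem primeInter_e₂_right (x : G.PrimeLattice) :
    G.primeInter x G.primeE₂ = G.duHom x.1 + x.2.1 := by
  simp [primeE₂, interFun]

/-- Field `inter_e₁_e₁`: `e₁·e₁ = 0`. -/
theorem primeInter_e₁_e₁ : G.primeInter G.primeE₁ G.primeE₁ = 0 := by simp [primeE₁, interFun]

/-- Field `inter_e₂_e₂`: `e₂·e₂ = 0`. -/
theorem primeInter_e₂_e₂ : G.primeInter G.primeE₂ G.primeE₂ = 0 := by simp [primeE₂, interFun]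

/-- Field `inter_e₁_e₂`: `e₁·e₂ = 1` (hyperbolic pair). -/
theorem primeInter_e₁_e₂ : G.primeInter G.primeE₁ G.primeE₂ = 1 := by
  simp [primeE₁, primeE₂, interFun]

/-- The cycle `Σ c_i frob i` of an integer combination is `(c, 0, 0)`. -/
theorem sum_smul_primeFrob (c : G.ι →₀ ℤ) :
    (c.sum fun i n ↦ n • G.primeFrob i) = (c, 0, 0) := by
  have h : ∀ (i : G.ι) (n : ℤ), n • G.primeFrob i = (Finsupp.single i n, 0, 0) := fun i n ↦ by
    ext <;> simp [primeFrob]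
  simp only [h]
  ext
  · simp only [Finsupp.sum, Prod.fst_sum]
    exact DFunLike.congr_fun (Finsupp.sum_single c) _
  · simp [Finsupp.sum, Prod.snd_sum]
  · simp [Finsupp.sum, Prod.snd_sum]

/-- Degree datum `D_c·e₁ = ∫ f_c d*u` — BY CONSTRUCTION. -/
theorem primeFrob_e₁ (c : G.ι →₀ ℤ) :
    G.primeInter (c.sum fun i n ↦ n • G.primeFrob i) G.primeE₁ =
      massDstar (toMul (testCombination G.φ c)) := by
  rw [sum_smul_primeFrob, primeInter_e₁_right]
  simp [dstarHom_apply]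

/-- Degree datum `D_c·e₂ = ∫ f_c du` — BY CONSTRUCTION. -/
theorem primeFrob_e₂ (c : G.ι →₀ ℤ) :
    G.primeInter (c.sum fun i n ↦ n • G.primeFrob i) G.primeE₂ =
      massDu (toMul (testCombination G.φ c)) := by
  rw [sum_smul_primeFrob, primeInter_e₂_right]
  simp [duHom_apply]

/-- Intersection datum `D_c·D_c = 2 𝔰(f_c, f_c)` — by construction and the PROVED identity
`2𝔰(f,f) − 2 d*(f) d_u(f) = −Re Q(u)` (`two_mul_ccPairing_sub_two_mul_masses_eq`). -/
theorem primeFrob_frob (c : G.ι →₀ ℤ) :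
    G.primeInter (c.sum fun i n ↦ n • G.primeFrob i) (c.sum fun i n ↦ n • G.primeFrob i) =
      2 * ccPairing (toMul (testCombination G.φ c)) (toMul (testCombination G.φ c)) := by
  rw [sum_smul_primeFrob]
  have h : 2 * ccPairing (toMul (testCombination G.φ c)) (toMul (testCombination G.φ c)) -
      2 * (massDstar (toMul (testCombination G.φ c)) * massDu (toMul (testCombination G.φ c))) =
        -(weilQuadratic (G.ctest c)).re :=
    two_mul_ccPairing_sub_two_mul_masses_eq (G.isWeilTest_ctest c)
  simp only [primeInter_apply, interFun, crossHom_apply, crossRe_self, dstarHom_apply, duHom_apply,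
    Int.cast_zero, zero_mul, add_zero]
  linarith [h]

/-- **The Hodge-index sign condition on the canonical carrier** — the ONLY field of
`ArithmeticWeilSurface` that the carrier does not satisfy by construction. -/
def PrimeHodge : Prop :=
  ∀ (n : ℕ) (v : Fin n → G.PrimeLattice) (a : Fin n → ℝ),
    (∑ k, a k * G.primeInter (v k) G.primeE₁ = 0) → (∑ k, a k * G.primeInter (v k) G.primeE₂ = 0) →
      ∑ k, ∑ l, a k * a l * G.primeInter (v k) (v l) ≤ 0

/-- **ALL AXIOMS EXCEPT THE SIGN CONDITION, FROM PRIME-SIDE DATA ALONE** (coordinator item (2),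
kernel form): for ANY generating family, the canonical carrier is an `ArithmeticWeilSurface` as
soon as — and only as soon as — the Hodge-index sign condition is supplied.  No zero of `ζ` and no
positivity statement enter the other twelve fields. -/
def ofHodge (h : G.PrimeHodge) : ArithmeticWeilSurface where
  gen := G
  L := G.PrimeLattice
  inter := G.primeInter
  inter_comm := G.primeInter_comm
  e₁ := G.primeE₁
  e₂ := G.primeE₂
  inter_e₁_e₁ := G.primeInter_e₁_e₁
  inter_e₂_e₂ := G.primeInter_e₂_e₂
  inter_e₁_e₂ := G.primeInter_e₁_e₂
  frob := G.primeFrob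
  frob_e₁ := G.primeFrob_e₁
  frob_e₂ := G.primeFrob_e₂
  frob_frob := G.primeFrob_frob
  hodge := h

/-- The generating family of the canonical carrier is `G`. -/
@[simp] theorem ofHodge_gen (h : G.PrimeHodge) : (G.ofHodge h).gen = G := rfl

/-! ## On the canonical carrier the Hodge form IS Weil's functional -/

/-- **The Hodge form of the canonical carrier**: for lattice vectors `v_k = (c_k, α_k, β_k)` and
real coefficients `a_k`,
`Σ_{k,l} a_k a_l v_k·v_l = 2 (Σ_k a_k v_k·e₁)(Σ_k a_k v_k·e₂) − Re Q(Σ_k a_k g_{c_k})`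
(the Gram expansion of `Re Q`, `PfPersistence.weilQuadratic_sum_eq_sum_weilCross`). -/
theorem sum_sum_primeInter (n : ℕ) (v : Fin n → G.PrimeLattice) (a : Fin n → ℝ) :
    ∑ k, ∑ l, a k * a l * G.primeInter (v k) (v l) =
      2 * (∑ k, a k * G.primeInter (v k) G.primeE₁) * (∑ k, a k * G.primeInter (v k) G.primeE₂)
        - (weilQuadratic fun t ↦ ∑ k, (a k : ℂ) * G.ctest (v k).1 t).re := by
  -- the Gram expansion of `Re Q` on the real combination
  have hQ : (weilQuadratic fun t ↦ ∑ k, (a k : ℂ) * G.ctest (v k).1 t).re =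
      ∑ k, ∑ l, a k * a l * G.crossRe (v k).1 (v l).1 := by
    rw [weilQuadratic_sum_eq_sum_weilCross Finset.univ (fun k ↦ G.isWeilTest_ctest (v k).1)
      (fun k ↦ (a k : ℂ)), Complex.re_sum]
    refine Finset.sum_congr rfl fun k _ ↦ ?_
    rw [Complex.re_sum]
    refine Finset.sum_congr rfl fun l _ ↦ ?_
    rw [Complex.conj_ofReal, ← Complex.ofReal_mul, Complex.re_ofReal_mul]
    rfl
  -- bookkeeping: split the summand into `T k l + T l k − a_k a_l B_{kl}`
  set p : Fin n → ℝ := fun k ↦ G.dstarHom (v k).1 with hp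
  set q : Fin n → ℝ := fun k ↦ G.duHom (v k).1 with hq
  set α : Fin n → ℝ := fun k ↦ ((v k).2.1 : ℝ) with hα
  set β : Fin n → ℝ := fun k ↦ ((v k).2.2 : ℝ) with hβ
  set T : Fin n → Fin n → ℝ := fun k l ↦ a k * (p k + β k) * (a l * (q l + α l)) with hT
  have h1 : ∀ k l, a k * a l * G.primeInter (v k) (v l) =
      T k l + T l k - a k * a l * G.crossRe (v k).1 (v l).1 := by
    intro k l
    simp only [primeInter_apply, interFun, crossHom_apply, hT, hp, hq, hα, hβ]
    ring
  have he₁ : ∑ k, a k * G.primeInter (v k) G.primeE₁ = ∑ k, a k * (p k + β k) := by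
    refine Finset.sum_congr rfl fun k _ ↦ ?_
    rw [primeInter_e₁_right]
  have he₂ : ∑ k, a k * G.primeInter (v k) G.primeE₂ = ∑ k, a k * (q k + α k) := by
    refine Finset.sum_congr rfl fun k _ ↦ ?_
    rw [primeInter_e₂_right]
  have h2 : ∑ k, ∑ l, T k l = (∑ k, a k * (p k + β k)) * (∑ l, a l * (q l + α l)) := by
    rw [Finset.sum_mul_sum]
  have h3 : ∑ k, ∑ l, T l k = ∑ k, ∑ l, T k l := Finset.sum_comm
  rw [hQ, he₁, he₂]
  calc ∑ k, ∑ l, a k * a l * G.primeInter (v k) (v l)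
      = ∑ k, ∑ l, (T k l + T l k - a k * a l * G.crossRe (v k).1 (v l).1) := by
        refine Finset.sum_congr rfl fun k _ ↦ Finset.sum_congr rfl fun l _ ↦ h1 k l
    _ = ∑ k, ∑ l, T k l + ∑ k, ∑ l, T l k - ∑ k, ∑ l, a k * a l * G.crossRe (v k).1 (v l).1 := by
        simp only [Finset.sum_add_distrib, Finset.sum_sub_distrib]
    _ = 2 * (∑ k, a k * (p k + β k)) * (∑ l, a l * (q l + α l))
          - ∑ k, ∑ l, a k * a l * G.crossRe (v k).1 (v l).1 := by
        rw [h3, h2]; ring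

/-- The real combination `Σ_k a_k g_{c_k}` is a Weil test function. -/
theorem isWeilTest_sum_ctest (n : ℕ) (c : Fin n → (G.ι →₀ ℤ)) (a : Fin n → ℝ) :
    IsWeilTest fun t ↦ ∑ k, (a k : ℂ) * G.ctest (c k) t :=
  isWeilTest_finset_sum Finset.univ fun k _ ↦ (G.isWeilTest_ctest (c k)).const_mul (a k : ℂ)

/-- **Weil positivity ⇒ the sign condition on the canonical carrier** (the tautological direction:
`hodge` on this carrier is Weil positivity on the real span of the family, nothing more). -/
theorem primeHodge_of_weilPositivity (hW : WeilPositivity) : G.PrimeHodge := by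
  intro n v a h₁ h₂
  rw [G.sum_sum_primeInter, h₁, h₂]
  have := hW _ (G.isWeilTest_sum_ctest n (fun k ↦ (v k).1) a)
  linarith

/-- **The sign condition on the canonical carrier ⇒ RH** (the carrier is then an
`ArithmeticWeilSurface`; apply the sprint theorem `riemannHypothesis_of_arithmeticWeilSurface`). -/
theorem riemannHypothesis_of_primeHodge (h : G.PrimeHodge) : _root_.RiemannHypothesis :=
  riemannHypothesis_of_arithmeticWeilSurface ⟨G.ofHodge h⟩

/-- **On the canonical carrier of any generating family, the Hodge-index sign condition is
EQUIVALENT to RH.** -/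
theorem primeHodge_iff_riemannHypothesis : G.PrimeHodge ↔ _root_.RiemannHypothesis :=
  ⟨G.riemannHypothesis_of_primeHodge, fun h ↦ G.primeHodge_of_weilPositivity
    ((show _root_.RiemannHypothesis ↔ WeilPositivity from weil_criterion_holds).mp h)⟩

end GeneratingFamily

/-! ## Satisfiability of the axiom list is equivalent to RH (honesty audit, kernel form) -/

/-- **The tautological converse**: RH ⇒ an arithmetic Weil surface exists — the canonical
prime-side carrier of the explicit `monomialBumpFamily`, whose sign condition is then Weil
positivity (`weil_criterion_holds`).  This is BOOKKEEPING, not geometry: it is why the existence of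
an `ArithmeticWeilSurface` as typed is not "strictly stronger than RH". -/
theorem nonempty_arithmeticWeilSurface_of_riemannHypothesis (h : _root_.RiemannHypothesis) :
    Nonempty ArithmeticWeilSurface :=
  ⟨monomialBumpFamily.ofHodge (monomialBumpFamily.primeHodge_of_weilPositivity
    ((show _root_.RiemannHypothesis ↔ WeilPositivity from weil_criterion_holds).mp h))⟩

/-- **SATISFIABILITY ⇔ RH** (referees' verdict, kernel-exact for literally this structure):
`Nonempty ArithmeticWeilSurface ↔ RiemannHypothesis` — forward by forcing
(`riemannHypothesis_of_arithmeticWeilSurface`: Hodge index on the lattice + density + the RH-free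
continuity of the prime-side data ⇒ Weil positivity ⇒ RH), backward by the canonical carrier.
The located gap is therefore NOT "does an AWS exist" but "does an INDEPENDENTLY constructed
(geometric / Arakelov) object satisfy `hodge` as a theorem". -/
theorem nonempty_arithmeticWeilSurface_iff_riemannHypothesis :
    Nonempty ArithmeticWeilSurface ↔ _root_.RiemannHypothesis :=
  ⟨riemannHypothesis_of_arithmeticWeilSurface, nonempty_arithmeticWeilSurface_of_riemannHypothesis⟩

end Summit.RiemannHypothesis.RiemannHypothesis.Theorems.MotivicDoor.AWS
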